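import Summits.BirchSwinnertonDyer.BirchSwinnertonDyer.Theorems.AlignedTransportAtTwoMainConjectureOfRankZeroBSDAtTwoSharedCubicDivisionField
import Summits.BirchSwinnertonDyer.BirchSwinnertonDyer.Theorems.AlignedTransportAtTwoMainConjectureOfRankZeroBSDAtTwoSexticNormRelationDescentSeedsB
import Summits.BirchSwinnertonDyer.BirchSwinnertonDyer.Theorems.AlignedTransportAtTwoMainConjectureOfRankZeroBSDAtTwoSexticResolventExactSeedsB
import HarnessLib

/-!
# Route `AlignedTransportAtTwo`, crux C2 `MainConjectureOfRankZeroBSDAtTwo` (stmt-BirchSwinnertonDyer-22298):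
# THE NINE ODD-BRANCH ROWS ARE NINE CUBIC-FIELD CLASSES — every curve whose `u`-cubic has a root in the cubic field of a certified row
# inherits the row's `μ₂(ℚ(W[2])) = 0`, its `λ₂`, resp. its `2`-class-number-free sextic tower, with no new certificate

HONEST FRAMING. WIDTH-5 attached prover seat `bsd-line-att-p4` g31 on line `birth` of the lead `bsd-line-att-p2`; `--supports`
stmt-BirchSwinnertonDyer-22298, closes nothing; BSD is NOT proved; crux C2, its verdict «blocked-on `Rank1Residual.GreenbergMuConjectureIrreducible`»
and every registered stub untouched. THEOREMS ONLY (no `def`, no named fact, no `sorry`). Sequel of this seat's `…SharedCubicDivisionField`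
(`e_n`, `μ₂`, `λ₂` of `ℚ(W[2])` agree for two curves sharing a cubic field) applied to the nine kernel rows of the odd-branch census with `N < 5000`
(att-p4 g27/g28 class number one, g28/g29 `…SexticNormRelationDescentSeeds{,B}`, g29 `…SexticResolventExactSeeds{,B}`: `λ₂(ℚ(W[2])^cyc) ∈ {0,0,0,0,2,2,4,4,64}`).

For each row curve `W_N` (conductor `N ∈ {307, 139, 3371, 3547, 1763, 2515, 3115, 4771, 4883}`, the models of the row files VERBATIM) and EVERY elliptic
`W/ℚ` with no rational `2`-torsion abscissa whose `u`-cubic `c_W` has a root in a cubic number field `F` that also contains a root of `c_{W_N}`: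
* rows `307b1`, `139a1`, `3371`, `3547` (`h(ℚ(β)) = 1`, resolvent tower `2`-free): **`e_n(ℚ(W[2])) = 0` for every `n`**, hence `μ₂ = λ₂ = 0`;
* rows `1763`, `2515`, `3115`, `4771`, `4883`: **`μ₂(ℚ(W[2])^cyc) = 0` and `λ₂(ℚ(W[2])^cyc) = 2, 2, 4, 4, 64`** respectively;
for every cyclotomic `ℤ₂`-extension of `ℚ(W[2])`. In particular all quadratic twists of the nine seeds and every `y² = f(x)` whose cubic resolvent field
is one of the nine are covered. With `…SharedCubicClassRigidity` (same seat): on the `Δ < 0`, rank-`0`, BSD₂ members of these classes MC₂ follows modulo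
PRINT + doors + MuIneqʳ. BSD is not proved by any of this.

References: [Washington1997] §13.1, §13.3; [Schettler2014] Thm. 2 (the `λ₂` values of the resolvents); [LMFDB] (the nine cubic fields); tree: the row files
named above and att-p4 g31 `…SharedCubicDivisionField`.
-/

-- the Theorems namespace of this sub repeats the summit name by design (D-0017 nested layout)
set_option linter.dupNamespace false
set_option autoImplicit false

noncomputable section

open scoped Classical NumberField

namespace Summit.BirchSwinnertonDyer.BirchSwinnertonDyer.Theorems.AlignedTransportAtTwoSharedCubicRowClasses

open NumberField Polynomial WeierstrassCurve IntermediateField Field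
  Literature.NumberTheory.EllipticCurves Literature.NumberTheory.EllipticCurves.Greenberg1999
  Literature.NumberTheory.EllipticCurves.ZpExtension Literature.NumberTheory.GaloisRepresentations
  Literature.NumberTheory.IwasawaTheory Literature.NumberTheory.NumberFields
  Summit.BirchSwinnertonDyer.Rank1Residual.F1Sign2
  Summit.BirchSwinnertonDyer.BirchSwinnertonDyer.Theorems.AlignedTransportAtTwoSharedCubicDivisionField
  Summit.BirchSwinnertonDyer.BirchSwinnertonDyer.Theorems.AlignedTransportAtTwoSexticNormRelationDescentSeeds
  Summit.BirchSwinnertonDyer.BirchSwinnertonDyer.Theorems.AlignedTransportAtTwoSexticNormRelationDescentSeedsB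
  Summit.BirchSwinnertonDyer.BirchSwinnertonDyer.Theorems.AlignedTransportAtTwoSexticResolventExactSeeds
  Summit.BirchSwinnertonDyer.BirchSwinnertonDyer.Theorems.AlignedTransportAtTwoSexticResolventExactSeedsB
  Summit.BirchSwinnertonDyer.BirchSwinnertonDyer.Theorems.AlignedTransportAtTwoCubicChevalleyRow307b1
  Summit.BirchSwinnertonDyer.BirchSwinnertonDyer.Theorems.AlignedTransportAtTwoCubicChevalleyRow139a1
  Summit.BirchSwinnertonDyer.BirchSwinnertonDyer.Theorems.AlignedTransportAtTwoCubicChevalleyRowN1763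
  Summit.BirchSwinnertonDyer.BirchSwinnertonDyer.Theorems.AlignedTransportAtTwoCubicChevalleyRowN2515
  Summit.BirchSwinnertonDyer.BirchSwinnertonDyer.Theorems.AlignedTransportAtTwoCubicChevalleyRowN3115
  Summit.BirchSwinnertonDyer.BirchSwinnertonDyer.Theorems.AlignedTransportAtTwoCubicChevalleyRowN3371
  Summit.BirchSwinnertonDyer.BirchSwinnertonDyer.Theorems.AlignedTransportAtTwoCubicChevalleyRowN3547
  Summit.BirchSwinnertonDyer.BirchSwinnertonDyer.Theorems.AlignedTransportAtTwoCubicChevalleyRowN4771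
  Summit.BirchSwinnertonDyer.BirchSwinnertonDyer.Theorems.AlignedTransportAtTwoCubicChevalleyRowN4883

variable (W : WeierstrassCurve ℚ) [W.IsElliptic] (ht : ∀ x : ℚ, ¬ HasRationalTwoTorsionX W x)
  {F : Type} [Field F] [NumberField F] (hF : Module.finrank ℚ F = 3) {e₁ e : F} (he : aeval e (twoDivisionUCubic W) = 0)

include ht hF he in
/-- **The class of row 307 (`307b1`)**: every elliptic `W/ℚ` with no rational `2`-torsion abscissa sharing the cubic field of the row curve `⟨1, 1, 0, 0, -1⟩`
(`e₁ ∈ F` a root of its `u`-cubic, `e ∈ F` a root of `c_W`, `[F:ℚ] = 3`) has a **`2`-CLASS-NUMBER-FREE sextic tower: `e_n(ℚ(W[2])) = 0` for every `n`**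
and every cyclotomic `ℤ₂`-extension (the row: `h(ℚ(β)) = 1`, one prime above `2`; resolvent tower `2`-free). [cite: Washington1997, §13.1] [cite: LMFDB, elliptic curve and cubic field of conductor 307] -/
theorem classNumberPExp_divisionField_two_eq_zero_of_shared_cubic_field_307b1 [((⟨1, 1, 0, 0, -1⟩ : WeierstrassCurve ℤ).baseChange ℚ).IsElliptic]
    (he₁ : aeval e₁ (twoDivisionUCubic ((⟨1, 1, 0, 0, -1⟩ : WeierstrassCurve ℤ).baseChange ℚ)) = 0)
    (κ : ZpExtension ↥(W.divisionField 2) 2) (hκ : κ.IsCyclotomic) (n : ℕ) : classNumberPExp κ n = 0 := by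
  haveI : NumberField ↥(((⟨1, 1, 0, 0, -1⟩ : WeierstrassCurve ℤ).baseChange ℚ).divisionField 2) := NumberField.mk
  obtain ⟨κ₁, hκ₁⟩ := exists_cyclotomicZpExtension_holds ↥(((⟨1, 1, 0, 0, -1⟩ : WeierstrassCurve ℤ).baseChange ℚ).divisionField 2) 2
  rw [← classNumberPExp_divisionField_two_eq_of_shared_cubic_field _ W not_hasRationalTwoTorsionX_307b1 ht hF he₁ he κ₁ hκ₁ κ hκ n]
  exact classNumberPExp_divisionField_two_307b1_eq_zero κ₁ hκ₁ n

include ht hF he in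
/-- **Row 307 (`307b1`)'s class: `μ₂(ℚ(W[2])^cyc) = 0` and `λ₂(ℚ(W[2])^cyc) = 0`** for every member `W` (growth form, every cyclotomic `ℤ₂`-extension).
[cite: RaySujatha2021, §1 eq. (1.1)] [cite: Washington1997, §13.3 Thm. 13.13] -/
theorem classicalLambda_divisionField_two_of_shared_cubic_field_307b1 [((⟨1, 1, 0, 0, -1⟩ : WeierstrassCurve ℤ).baseChange ℚ).IsElliptic]
    (he₁ : aeval e₁ (twoDivisionUCubic ((⟨1, 1, 0, 0, -1⟩ : WeierstrassCurve ℤ).baseChange ℚ)) = 0)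
    (κ : ZpExtension ↥(W.divisionField 2) 2) (hκ : κ.IsCyclotomic) : ClassicalMuVanishes κ ∧ classicalLambda κ = 0 :=
  have h0 := classNumberPExp_divisionField_two_eq_zero_of_shared_cubic_field_307b1 W ht hF he he₁ κ hκ
  ⟨classicalMuVanishes_of_eventually_const κ (n₀ := 0) fun n _ ↦ h0 n,
    classicalLambda_eq_zero_of_eventually_const κ (n₀ := 0) fun n _ ↦ h0 n⟩

include ht hF he in
/-- **The class of row 139 (`139a1`)**: every elliptic `W/ℚ` with no rational `2`-torsion abscissa sharing the cubic field of the row curve `⟨1, 1, 0, -3, -4⟩`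
(`e₁ ∈ F` a root of its `u`-cubic, `e ∈ F` a root of `c_W`, `[F:ℚ] = 3`) has a **`2`-CLASS-NUMBER-FREE sextic tower: `e_n(ℚ(W[2])) = 0` for every `n`**
and every cyclotomic `ℤ₂`-extension (the row: `h(ℚ(β)) = 1`, one prime above `2`; resolvent tower `2`-free). [cite: Washington1997, §13.1] [cite: LMFDB, elliptic curve and cubic field of conductor 139] -/
theorem classNumberPExp_divisionField_two_eq_zero_of_shared_cubic_field_139a1 [((⟨1, 1, 0, -3, -4⟩ : WeierstrassCurve ℤ).baseChange ℚ).IsElliptic]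
    (he₁ : aeval e₁ (twoDivisionUCubic ((⟨1, 1, 0, -3, -4⟩ : WeierstrassCurve ℤ).baseChange ℚ)) = 0)
    (κ : ZpExtension ↥(W.divisionField 2) 2) (hκ : κ.IsCyclotomic) (n : ℕ) : classNumberPExp κ n = 0 := by
  haveI : NumberField ↥(((⟨1, 1, 0, -3, -4⟩ : WeierstrassCurve ℤ).baseChange ℚ).divisionField 2) := NumberField.mk
  obtain ⟨κ₁, hκ₁⟩ := exists_cyclotomicZpExtension_holds ↥(((⟨1, 1, 0, -3, -4⟩ : WeierstrassCurve ℤ).baseChange ℚ).divisionField 2) 2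
  rw [← classNumberPExp_divisionField_two_eq_of_shared_cubic_field _ W not_hasRationalTwoTorsionX_139a1 ht hF he₁ he κ₁ hκ₁ κ hκ n]
  exact classNumberPExp_divisionField_two_139a1_eq_zero κ₁ hκ₁ n

include ht hF he in
/-- **Row 139 (`139a1`)'s class: `μ₂(ℚ(W[2])^cyc) = 0` and `λ₂(ℚ(W[2])^cyc) = 0`** for every member `W` (growth form, every cyclotomic `ℤ₂`-extension).
[cite: RaySujatha2021, §1 eq. (1.1)] [cite: Washington1997, §13.3 Thm. 13.13] -/
theorem classicalLambda_divisionField_two_of_shared_cubic_field_139a1 [((⟨1, 1, 0, -3, -4⟩ : WeierstrassCurve ℤ).baseChange ℚ).IsElliptic]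
    (he₁ : aeval e₁ (twoDivisionUCubic ((⟨1, 1, 0, -3, -4⟩ : WeierstrassCurve ℤ).baseChange ℚ)) = 0)
    (κ : ZpExtension ↥(W.divisionField 2) 2) (hκ : κ.IsCyclotomic) : ClassicalMuVanishes κ ∧ classicalLambda κ = 0 :=
  have h0 := classNumberPExp_divisionField_two_eq_zero_of_shared_cubic_field_139a1 W ht hF he he₁ κ hκ
  ⟨classicalMuVanishes_of_eventually_const κ (n₀ := 0) fun n _ ↦ h0 n,
    classicalLambda_eq_zero_of_eventually_const κ (n₀ := 0) fun n _ ↦ h0 n⟩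

include ht hF he in
/-- **The class of row 3371**: every elliptic `W/ℚ` with no rational `2`-torsion abscissa sharing the cubic field of the row curve `⟨1, 0, 1, 0, -3⟩`
(`e₁ ∈ F` a root of its `u`-cubic, `e ∈ F` a root of `c_W`, `[F:ℚ] = 3`) has a **`2`-CLASS-NUMBER-FREE sextic tower: `e_n(ℚ(W[2])) = 0` for every `n`**
and every cyclotomic `ℤ₂`-extension (the row: `h(ℚ(β)) = 1`, one prime above `2`; resolvent tower `2`-free). [cite: Washington1997, §13.1] [cite: LMFDB, elliptic curve and cubic field of conductor 3371] -/
theorem classNumberPExp_divisionField_two_eq_zero_of_shared_cubic_field_n3371 [((⟨1, 0, 1, 0, -3⟩ : WeierstrassCurve ℤ).baseChange ℚ).IsElliptic]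
    (he₁ : aeval e₁ (twoDivisionUCubic ((⟨1, 0, 1, 0, -3⟩ : WeierstrassCurve ℤ).baseChange ℚ)) = 0)
    (κ : ZpExtension ↥(W.divisionField 2) 2) (hκ : κ.IsCyclotomic) (n : ℕ) : classNumberPExp κ n = 0 := by
  haveI : NumberField ↥(((⟨1, 0, 1, 0, -3⟩ : WeierstrassCurve ℤ).baseChange ℚ).divisionField 2) := NumberField.mk
  obtain ⟨κ₁, hκ₁⟩ := exists_cyclotomicZpExtension_holds ↥(((⟨1, 0, 1, 0, -3⟩ : WeierstrassCurve ℤ).baseChange ℚ).divisionField 2) 2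
  rw [← classNumberPExp_divisionField_two_eq_of_shared_cubic_field _ W not_hasRationalTwoTorsionX_n3371 ht hF he₁ he κ₁ hκ₁ κ hκ n]
  exact classNumberPExp_divisionField_two_n3371_eq_zero κ₁ hκ₁ n

include ht hF he in
/-- **Row 3371's class: `μ₂(ℚ(W[2])^cyc) = 0` and `λ₂(ℚ(W[2])^cyc) = 0`** for every member `W` (growth form, every cyclotomic `ℤ₂`-extension).
[cite: RaySujatha2021, §1 eq. (1.1)] [cite: Washington1997, §13.3 Thm. 13.13] -/
theorem classicalLambda_divisionField_two_of_shared_cubic_field_n3371 [((⟨1, 0, 1, 0, -3⟩ : WeierstrassCurve ℤ).baseChange ℚ).IsElliptic]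
    (he₁ : aeval e₁ (twoDivisionUCubic ((⟨1, 0, 1, 0, -3⟩ : WeierstrassCurve ℤ).baseChange ℚ)) = 0)
    (κ : ZpExtension ↥(W.divisionField 2) 2) (hκ : κ.IsCyclotomic) : ClassicalMuVanishes κ ∧ classicalLambda κ = 0 :=
  have h0 := classNumberPExp_divisionField_two_eq_zero_of_shared_cubic_field_n3371 W ht hF he he₁ κ hκ
  ⟨classicalMuVanishes_of_eventually_const κ (n₀ := 0) fun n _ ↦ h0 n,
    classicalLambda_eq_zero_of_eventually_const κ (n₀ := 0) fun n _ ↦ h0 n⟩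

include ht hF he in
/-- **The class of row 3547**: every elliptic `W/ℚ` with no rational `2`-torsion abscissa sharing the cubic field of the row curve `⟨1, -1, 0, 4, -1⟩`
(`e₁ ∈ F` a root of its `u`-cubic, `e ∈ F` a root of `c_W`, `[F:ℚ] = 3`) has a **`2`-CLASS-NUMBER-FREE sextic tower: `e_n(ℚ(W[2])) = 0` for every `n`**
and every cyclotomic `ℤ₂`-extension (the row: `h(ℚ(β)) = 1`, one prime above `2`; resolvent tower `2`-free). [cite: Washington1997, §13.1] [cite: LMFDB, elliptic curve and cubic field of conductor 3547] -/
theorem classNumberPExp_divisionField_two_eq_zero_of_shared_cubic_field_n3547 [((⟨1, -1, 0, 4, -1⟩ : WeierstrassCurve ℤ).baseChange ℚ).IsElliptic]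
    (he₁ : aeval e₁ (twoDivisionUCubic ((⟨1, -1, 0, 4, -1⟩ : WeierstrassCurve ℤ).baseChange ℚ)) = 0)
    (κ : ZpExtension ↥(W.divisionField 2) 2) (hκ : κ.IsCyclotomic) (n : ℕ) : classNumberPExp κ n = 0 := by
  haveI : NumberField ↥(((⟨1, -1, 0, 4, -1⟩ : WeierstrassCurve ℤ).baseChange ℚ).divisionField 2) := NumberField.mk
  obtain ⟨κ₁, hκ₁⟩ := exists_cyclotomicZpExtension_holds ↥(((⟨1, -1, 0, 4, -1⟩ : WeierstrassCurve ℤ).baseChange ℚ).divisionField 2) 2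
  rw [← classNumberPExp_divisionField_two_eq_of_shared_cubic_field _ W not_hasRationalTwoTorsionX_n3547 ht hF he₁ he κ₁ hκ₁ κ hκ n]
  exact classNumberPExp_divisionField_two_n3547_eq_zero κ₁ hκ₁ n

include ht hF he in
/-- **Row 3547's class: `μ₂(ℚ(W[2])^cyc) = 0` and `λ₂(ℚ(W[2])^cyc) = 0`** for every member `W` (growth form, every cyclotomic `ℤ₂`-extension).
[cite: RaySujatha2021, §1 eq. (1.1)] [cite: Washington1997, §13.3 Thm. 13.13] -/
theorem classicalLambda_divisionField_two_of_shared_cubic_field_n3547 [((⟨1, -1, 0, 4, -1⟩ : WeierstrassCurve ℤ).baseChange ℚ).IsElliptic]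
    (he₁ : aeval e₁ (twoDivisionUCubic ((⟨1, -1, 0, 4, -1⟩ : WeierstrassCurve ℤ).baseChange ℚ)) = 0)
    (κ : ZpExtension ↥(W.divisionField 2) 2) (hκ : κ.IsCyclotomic) : ClassicalMuVanishes κ ∧ classicalLambda κ = 0 :=
  have h0 := classNumberPExp_divisionField_two_eq_zero_of_shared_cubic_field_n3547 W ht hF he he₁ κ hκ
  ⟨classicalMuVanishes_of_eventually_const κ (n₀ := 0) fun n _ ↦ h0 n,
    classicalLambda_eq_zero_of_eventually_const κ (n₀ := 0) fun n _ ↦ h0 n⟩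

include ht hF he in
/-- **The class of row 1763**: every elliptic `W/ℚ` with no rational `2`-torsion abscissa sharing the cubic field of the row curve `⟨1, 0, 1, -3, -3⟩`
(`e₁ ∈ F` a root of its `u`-cubic, `e ∈ F` a root of `c_W`, `[F:ℚ] = 3`) has **`μ₂(ℚ(W[2])^cyc) = 0` and `λ₂(ℚ(W[2])^cyc) = 2`** for every cyclotomic
`ℤ₂`-extension of `ℚ(W[2])` (growth form; the row's value, Ferrero–Kida on the resolvent + the exact `S₃` identity + class number one of `ℚ(β)`).
[cite: Schettler2014, Thm. 2] [cite: Washington1997, §13.3 Thm. 13.13] [cite: LMFDB, elliptic curve and cubic field of conductor 1763] -/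
theorem classicalLambda_divisionField_two_of_shared_cubic_field_n1763 [((⟨1, 0, 1, -3, -3⟩ : WeierstrassCurve ℤ).baseChange ℚ).IsElliptic]
    (he₁ : aeval e₁ (twoDivisionUCubic ((⟨1, 0, 1, -3, -3⟩ : WeierstrassCurve ℤ).baseChange ℚ)) = 0)
    (κ : ZpExtension ↥(W.divisionField 2) 2) (hκ : κ.IsCyclotomic) : ClassicalMuVanishes κ ∧ classicalLambda κ = 2 := by
  haveI : NumberField ↥(((⟨1, 0, 1, -3, -3⟩ : WeierstrassCurve ℤ).baseChange ℚ).divisionField 2) := NumberField.mk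
  obtain ⟨κ₁, hκ₁⟩ := exists_cyclotomicZpExtension_holds ↥(((⟨1, 0, 1, -3, -3⟩ : WeierstrassCurve ℤ).baseChange ℚ).divisionField 2) 2
  obtain ⟨hμ, hl⟩ := classicalLambda_divisionField_two_n1763 κ₁ hκ₁
  exact ⟨(classicalMuVanishes_divisionField_two_iff_of_shared_cubic_field _ W not_hasRationalTwoTorsionX_n1763 ht hF he₁ he κ₁ hκ₁ κ hκ).mp hμ,
    (classicalLambda_divisionField_two_eq_of_shared_cubic_field _ W not_hasRationalTwoTorsionX_n1763 ht hF he₁ he κ₁ hκ₁ κ hκ).symm.trans hl⟩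

include ht hF he in
/-- **The class of row 2515**: every elliptic `W/ℚ` with no rational `2`-torsion abscissa sharing the cubic field of the row curve `⟨1, 1, 0, 2, 3⟩`
(`e₁ ∈ F` a root of its `u`-cubic, `e ∈ F` a root of `c_W`, `[F:ℚ] = 3`) has **`μ₂(ℚ(W[2])^cyc) = 0` and `λ₂(ℚ(W[2])^cyc) = 2`** for every cyclotomic
`ℤ₂`-extension of `ℚ(W[2])` (growth form; the row's value, Ferrero–Kida on the resolvent + the exact `S₃` identity + class number one of `ℚ(β)`).
[cite: Schettler2014, Thm. 2] [cite: Washington1997, §13.3 Thm. 13.13] [cite: LMFDB, elliptic curve and cubic field of conductor 2515] -/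
theorem classicalLambda_divisionField_two_of_shared_cubic_field_n2515 [((⟨1, 1, 0, 2, 3⟩ : WeierstrassCurve ℤ).baseChange ℚ).IsElliptic]
    (he₁ : aeval e₁ (twoDivisionUCubic ((⟨1, 1, 0, 2, 3⟩ : WeierstrassCurve ℤ).baseChange ℚ)) = 0)
    (κ : ZpExtension ↥(W.divisionField 2) 2) (hκ : κ.IsCyclotomic) : ClassicalMuVanishes κ ∧ classicalLambda κ = 2 := by
  haveI : NumberField ↥(((⟨1, 1, 0, 2, 3⟩ : WeierstrassCurve ℤ).baseChange ℚ).divisionField 2) := NumberField.mk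
  obtain ⟨κ₁, hκ₁⟩ := exists_cyclotomicZpExtension_holds ↥(((⟨1, 1, 0, 2, 3⟩ : WeierstrassCurve ℤ).baseChange ℚ).divisionField 2) 2
  obtain ⟨hμ, hl⟩ := classicalLambda_divisionField_two_n2515 κ₁ hκ₁
  exact ⟨(classicalMuVanishes_divisionField_two_iff_of_shared_cubic_field _ W not_hasRationalTwoTorsionX_n2515 ht hF he₁ he κ₁ hκ₁ κ hκ).mp hμ,
    (classicalLambda_divisionField_two_eq_of_shared_cubic_field _ W not_hasRationalTwoTorsionX_n2515 ht hF he₁ he κ₁ hκ₁ κ hκ).symm.trans hl⟩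

include ht hF he in
/-- **The class of row 3115**: every elliptic `W/ℚ` with no rational `2`-torsion abscissa sharing the cubic field of the row curve `⟨1, -1, 0, -5, -4⟩`
(`e₁ ∈ F` a root of its `u`-cubic, `e ∈ F` a root of `c_W`, `[F:ℚ] = 3`) has **`μ₂(ℚ(W[2])^cyc) = 0` and `λ₂(ℚ(W[2])^cyc) = 4`** for every cyclotomic
`ℤ₂`-extension of `ℚ(W[2])` (growth form; the row's value, Ferrero–Kida on the resolvent + the exact `S₃` identity + class number one of `ℚ(β)`).
[cite: Schettler2014, Thm. 2] [cite: Washington1997, §13.3 Thm. 13.13] [cite: LMFDB, elliptic curve and cubic field of conductor 3115] -/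
theorem classicalLambda_divisionField_two_of_shared_cubic_field_n3115 [((⟨1, -1, 0, -5, -4⟩ : WeierstrassCurve ℤ).baseChange ℚ).IsElliptic]
    (he₁ : aeval e₁ (twoDivisionUCubic ((⟨1, -1, 0, -5, -4⟩ : WeierstrassCurve ℤ).baseChange ℚ)) = 0)
    (κ : ZpExtension ↥(W.divisionField 2) 2) (hκ : κ.IsCyclotomic) : ClassicalMuVanishes κ ∧ classicalLambda κ = 4 := by
  haveI : NumberField ↥(((⟨1, -1, 0, -5, -4⟩ : WeierstrassCurve ℤ).baseChange ℚ).divisionField 2) := NumberField.mk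
  obtain ⟨κ₁, hκ₁⟩ := exists_cyclotomicZpExtension_holds ↥(((⟨1, -1, 0, -5, -4⟩ : WeierstrassCurve ℤ).baseChange ℚ).divisionField 2) 2
  obtain ⟨hμ, hl⟩ := classicalLambda_divisionField_two_n3115 κ₁ hκ₁
  exact ⟨(classicalMuVanishes_divisionField_two_iff_of_shared_cubic_field _ W not_hasRationalTwoTorsionX_n3115 ht hF he₁ he κ₁ hκ₁ κ hκ).mp hμ,
    (classicalLambda_divisionField_two_eq_of_shared_cubic_field _ W not_hasRationalTwoTorsionX_n3115 ht hF he₁ he κ₁ hκ₁ κ hκ).symm.trans hl⟩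

include ht hF he in
/-- **The class of row 4771**: every elliptic `W/ℚ` with no rational `2`-torsion abscissa sharing the cubic field of the row curve `⟨1, -1, 0, -11, -12⟩`
(`e₁ ∈ F` a root of its `u`-cubic, `e ∈ F` a root of `c_W`, `[F:ℚ] = 3`) has **`μ₂(ℚ(W[2])^cyc) = 0` and `λ₂(ℚ(W[2])^cyc) = 4`** for every cyclotomic
`ℤ₂`-extension of `ℚ(W[2])` (growth form; the row's value, Ferrero–Kida on the resolvent + the exact `S₃` identity + class number one of `ℚ(β)`).
[cite: Schettler2014, Thm. 2] [cite: Washington1997, §13.3 Thm. 13.13] [cite: LMFDB, elliptic curve and cubic field of conductor 4771] -/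
theorem classicalLambda_divisionField_two_of_shared_cubic_field_n4771 [((⟨1, -1, 0, -11, -12⟩ : WeierstrassCurve ℤ).baseChange ℚ).IsElliptic]
    (he₁ : aeval e₁ (twoDivisionUCubic ((⟨1, -1, 0, -11, -12⟩ : WeierstrassCurve ℤ).baseChange ℚ)) = 0)
    (κ : ZpExtension ↥(W.divisionField 2) 2) (hκ : κ.IsCyclotomic) : ClassicalMuVanishes κ ∧ classicalLambda κ = 4 := by
  haveI : NumberField ↥(((⟨1, -1, 0, -11, -12⟩ : WeierstrassCurve ℤ).baseChange ℚ).divisionField 2) := NumberField.mk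
  obtain ⟨κ₁, hκ₁⟩ := exists_cyclotomicZpExtension_holds ↥(((⟨1, -1, 0, -11, -12⟩ : WeierstrassCurve ℤ).baseChange ℚ).divisionField 2) 2
  obtain ⟨hμ, hl⟩ := classicalLambda_divisionField_two_n4771 κ₁ hκ₁
  exact ⟨(classicalMuVanishes_divisionField_two_iff_of_shared_cubic_field _ W not_hasRationalTwoTorsionX_n4771 ht hF he₁ he κ₁ hκ₁ κ hκ).mp hμ,
    (classicalLambda_divisionField_two_eq_of_shared_cubic_field _ W not_hasRationalTwoTorsionX_n4771 ht hF he₁ he κ₁ hκ₁ κ hκ).symm.trans hl⟩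

include ht hF he in
/-- **The class of row 4883**: every elliptic `W/ℚ` with no rational `2`-torsion abscissa sharing the cubic field of the row curve `⟨1, 1, 0, -1, -4⟩`
(`e₁ ∈ F` a root of its `u`-cubic, `e ∈ F` a root of `c_W`, `[F:ℚ] = 3`) has **`μ₂(ℚ(W[2])^cyc) = 0` and `λ₂(ℚ(W[2])^cyc) = 64`** for every cyclotomic
`ℤ₂`-extension of `ℚ(W[2])` (growth form; the row's value, Ferrero–Kida on the resolvent + the exact `S₃` identity + class number one of `ℚ(β)`).
[cite: Schettler2014, Thm. 2] [cite: Washington1997, §13.3 Thm. 13.13] [cite: LMFDB, elliptic curve and cubic field of conductor 4883] -/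
theorem classicalLambda_divisionField_two_of_shared_cubic_field_n4883 [((⟨1, 1, 0, -1, -4⟩ : WeierstrassCurve ℤ).baseChange ℚ).IsElliptic]
    (he₁ : aeval e₁ (twoDivisionUCubic ((⟨1, 1, 0, -1, -4⟩ : WeierstrassCurve ℤ).baseChange ℚ)) = 0)
    (κ : ZpExtension ↥(W.divisionField 2) 2) (hκ : κ.IsCyclotomic) : ClassicalMuVanishes κ ∧ classicalLambda κ = 64 := by
  haveI : NumberField ↥(((⟨1, 1, 0, -1, -4⟩ : WeierstrassCurve ℤ).baseChange ℚ).divisionField 2) := NumberField.mk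
  obtain ⟨κ₁, hκ₁⟩ := exists_cyclotomicZpExtension_holds ↥(((⟨1, 1, 0, -1, -4⟩ : WeierstrassCurve ℤ).baseChange ℚ).divisionField 2) 2
  obtain ⟨hμ, hl⟩ := classicalLambda_divisionField_two_n4883 κ₁ hκ₁
  exact ⟨(classicalMuVanishes_divisionField_two_iff_of_shared_cubic_field _ W not_hasRationalTwoTorsionX_n4883 ht hF he₁ he κ₁ hκ₁ κ hκ).mp hμ,
    (classicalLambda_divisionField_two_eq_of_shared_cubic_field _ W not_hasRationalTwoTorsionX_n4883 ht hF he₁ he κ₁ hκ₁ κ hκ).symm.trans hl⟩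

end Summit.BirchSwinnertonDyer.BirchSwinnertonDyer.Theorems.AlignedTransportAtTwoSharedCubicRowClasses

end
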